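import Mathlib
import Summits.MatrixMultiplication.MatrixMultiplication.Theorems.SoloBlindKraftDecomposition
import Summits.MatrixMultiplication.MatrixMultiplication.Theorems.SoloBlindKraftHyperplane

/-!
# Solo-blind seat (MatrixMultiplication), s68 — the residual pattern (3,0) of (K₃) reduces to the THREE-POINT inequality
(TRIANGLE.md (R18.4)/(R18.7), CLAIMS c650/c651/c657; brief `paper/KraftK3.md` §3(d))

With `q : G →+ ZMod 3`, `w` = the terms of `h` in `ker q`, and exactly three terms `a, b, c` outside, all on the same
side (`q (h a) = q (h b) = q (h c) = 1`): the Kraft bound for `h` follows from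
* `T1`  — the Kraft bound for `w`,
* `T2`  — the Kraft bound for `w ∪ {h a + h b + h c}` in expanded form, and
* `H3` — the THREE-POINT INEQUALITY for `w` at the triple `(σ - h a, σ - h b, σ - h c)`:
  `K_w(σ - h a) + K_w(σ - h b) + K_w(σ - h c) ≤ 2`.
So, given the Kraft bounds of shorter sub-sum sequences, pattern (3,0) — the dominant non-flat pattern of the
indecomposable maximum zero-sum-free sets (6556 of the 6646 non-flat normal forms in rank 4) — is EXACTLY as hard as
the three-point inequality (3PT); the formal LP shows no positive combination of Kraft bounds alone suffices (value 3/2).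
-/

set_option linter.dupNamespace false

namespace Summit.MatrixMultiplication.MatrixMultiplication.Theorems

open Finset BigOperators
open scoped Classical

section KraftThreePoint

variable {ι : Type*} {G : Type*} [AddCommGroup G]

/-- Pattern (3,0): three outside terms on the same side; Kraft ≤ 1 from `T1`, the block tool `T2` and the
three-point inequality `H3`. -/
theorem soloBlind_kraft_pattern30 (s : Finset ι) (h : ι → G) (q : G →+ ZMod 3) (a b c : ι)
    (hab : a ≠ b) (hac : a ≠ c) (hbc : b ≠ c)
    (hu : (s.filter fun i => ¬ q (h i) = 0) = {a, b, c})
    (hqa : q (h a) = 1) (hqb : q (h b) = 1) (hqc : q (h c) = 1)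
    (T1 : ∀ σ, soloBlindKraft (s.filter fun i => q (h i) = 0) h σ ≤ 1)
    (T2 : ∀ σ, soloBlindKraft (s.filter fun i => q (h i) = 0) h σ
        + (1/2 : ℚ) * soloBlindKraft (s.filter fun i => q (h i) = 0) h (σ - (h a + (h b + h c))) ≤ 1)
    (H3 : ∀ σ, soloBlindKraft (s.filter fun i => q (h i) = 0) h (σ - h a)
        + soloBlindKraft (s.filter fun i => q (h i) = 0) h (σ - h b)
        + soloBlindKraft (s.filter fun i => q (h i) = 0) h (σ - h c) ≤ 2)
    (τ : G) : soloBlindKraft s h τ ≤ 1 := by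
  have key : soloBlindKraft s h τ = ∑ S ∈ (s.filter fun i => ¬ q (h i) = 0).powerset,
      (1/2 : ℚ) ^ S.card * soloBlindKraft (s.filter fun i => q (h i) = 0) h (τ - ∑ i ∈ S, h i) := by
    convert soloBlindKraft_split s h (fun i => q (h i) = 0) τ
  rw [key, hu]
  set w := s.filter fun i => q (h i) = 0 with hw_def
  have hwK : ∀ i ∈ w, h i ∈ q.ker := fun i hi => by
    rw [AddMonoidHom.mem_ker]; exact (Finset.mem_filter.mp hi).2
  have van : ∀ σ, q σ ≠ 0 → soloBlindKraft w h σ = 0 := fun σ hσ =>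
    soloBlindKraft_eq_zero_of_not_mem w h q.ker hwK (by rwa [AddMonoidHom.mem_ker])
  have nn : ∀ σ, 0 ≤ soloBlindKraft w h σ := fun σ => soloBlindKraft_nonneg w h σ
  have hnab : a ∉ ({b, c} : Finset ι) := by simp [hab, hac]
  have hnbc : b ∉ ({c} : Finset ι) := by simp [hbc]
  have hpc : ({c} : Finset ι).powerset = {∅, {c}} := by
    ext t; simp [Finset.subset_singleton_iff]
  have hne : (∅ : Finset ι) ≠ {c} := (Finset.singleton_ne_empty c).symm
  have hac' : a ∉ ({c} : Finset ι) := by simp [hac]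
  have hab' : a ∉ ({b} : Finset ι) := by simp [hab]
  simp only [Finset.sum_powerset_insert hnab, Finset.sum_powerset_insert hnbc, hpc, Finset.sum_pair hne,
    Finset.insert_empty, Finset.sum_empty, Finset.sum_singleton, Finset.card_empty, Finset.card_singleton,
    Finset.sum_insert hnbc, Finset.sum_insert hac', Finset.sum_insert hab', Finset.sum_insert hnab,
    Finset.card_insert_of_notMem hnbc, Finset.card_insert_of_notMem hac',
    Finset.card_insert_of_notMem hab', Finset.card_insert_of_notMem hnab, pow_zero, one_mul, sub_zero]
  norm_num
  have q1 : q (τ - h c) = q τ - 1 := by rw [map_sub, hqc]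
  have q2 : q (τ - h b) = q τ - 1 := by rw [map_sub, hqb]
  have q3 : q (τ - (h b + h c)) = q τ - 2 := by rw [map_sub, map_add, hqb, hqc]; ring
  have q4 : q (τ - h a) = q τ - 1 := by rw [map_sub, hqa]
  have q5 : q (τ - (h a + h c)) = q τ - 2 := by rw [map_sub, map_add, hqa, hqc]; ring
  have q6 : q (τ - (h a + h b)) = q τ - 2 := by rw [map_sub, map_add, hqa, hqb]; ring
  have q7 : q (τ - (h a + (h b + h c))) = q τ - 3 := by
    rw [map_sub, map_add, map_add, hqa, hqb, hqc]; ring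
  rcases soloBlind_zmod_three_cases (q τ) with h0 | h1 | h2
  · -- class 0: survivors ∅ and {a,b,c}; certificate T2
    have z1 := van (τ - h c) (by rw [q1, h0]; decide)
    have z2 := van (τ - h b) (by rw [q2, h0]; decide)
    have z3 := van (τ - (h b + h c)) (by rw [q3, h0]; decide)
    have z4 := van (τ - h a) (by rw [q4, h0]; decide)
    have z5 := van (τ - (h a + h c)) (by rw [q5, h0]; decide)
    have z6 := van (τ - (h a + h b)) (by rw [q6, h0]; decide)
    have t2 := T2 τ
    have n7 := nn (τ - (h a + (h b + h c)))
    linarith [z1, z2, z3, z4, z5, z6]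
  · -- class 1: survivors {a}, {b}, {c}; certificate ½ H3
    have z0 := van τ (by rw [h1]; decide)
    have z3 := van (τ - (h b + h c)) (by rw [q3, h1]; decide)
    have z5 := van (τ - (h a + h c)) (by rw [q5, h1]; decide)
    have z6 := van (τ - (h a + h b)) (by rw [q6, h1]; decide)
    have z7 := van (τ - (h a + (h b + h c))) (by rw [q7, h1]; decide)
    have t := H3 τ
    linarith [z0, z3, z5, z6, z7]
  · -- class 2: survivors {b,c}, {a,c}, {a,b}; certificate ¼ (T1 + T1 + T1)
    have z0 := van τ (by rw [h2]; decide)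
    have z1 := van (τ - h c) (by rw [q1, h2]; decide)
    have z2 := van (τ - h b) (by rw [q2, h2]; decide)
    have z4 := van (τ - h a) (by rw [q4, h2]; decide)
    have z7 := van (τ - (h a + (h b + h c))) (by rw [q7, h2]; decide)
    have t3 := T1 (τ - (h b + h c)); have t5 := T1 (τ - (h a + h c)); have t6 := T1 (τ - (h a + h b))
    linarith [z0, z1, z2, z4, z7]

end KraftThreePoint

end Summit.MatrixMultiplication.MatrixMultiplication.Theorems
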